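import Literature.Computability.Cryptography.LWEPrimePowerProgBricks
import Literature.Computability.Cryptography.LWEPrimePowerSchedule
import Literature.Computability.Cryptography.LWESampleCodes
import Literature.Computability.Complexity.TM2Iterate
import HarnessLib

/-!
# The Micciancio–Peikert machine, I: list-level data, the sample-tuple code, and the parameter schedule on codes

Topic `Computability/Cryptography` (LWE), grouping namespace `LWE.MP12.Prog`, sequel of
`LWEPrimePowerProgBricks.lean` (typed polynomial-time bricks) with `LWEPrimePowerSchedule.lean`
(the schedule `dim, lev, aggK, invGap, trials, reps, meas, extra` of BLPRS's setting) and
`LWESampleCodes.lean` (`encodeLWESamples` field by field). Proved material (no named fact) towards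
`Literature.Computability.Cryptography.blprs_gapSVP_sqrt_dim_to_lwe_classical` (**pqc.S21**),
hypothesis `h₂` of `blprs_gapSVP_sqrt_dim_to_lwe_classical_of_components`: the oracle machine is
ONE string function for all dimensions, so it works on raw LIST data:

* `LItem = List ℕ × ℕ` (a sample `(a, b)` by representatives), `LData = ℕ × (ℕ × List LItem)`
  (`(d, (Q, samples))`), their codes `itemE`, `ldataE`, and **`ldataE_toLData`**: the code of the
  list form `toLData S` of a typed tuple `S` IS `encodeLWESamples S` (so a query assembled on lists,
  paired with the unary tag, is literally the tagged code the analysis speaks of); the uniform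
  length bound `ldataBound`/`length_encodeLWESamples_le_ldataBound`.
* the schedule as a tuple of numbers `prmOf c m₂ coinsD n = (d, e, Q, m, K, invGap, T, N, N', m', ℓ)`
  with `ℓ = coinsD (2n + 2 + ldataBound d Q m)` (the coins the distinguisher may read on any query),
  and **`codeFP_prmOf`**: it is computed from `1ⁿ` in polynomial time (`m₂` polynomial-time
  computable from `1ⁿ`, `coinsD` a fixed polynomial); `prmOf_eq` identifies the components with
  the schedule (`aggK n = logSucc n ^ 4`).

## References

* D. Micciancio, C. Peikert, *Trapdoors for lattices: simpler, tighter, faster, smaller*, EUROCRYPT 2012,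
  LNCS 7237; full version IACR ePrint 2011/501, §3, Thm. 3.1. [MicciancioPeikert2012]
* S. Arora, B. Barak, *Computational Complexity: A Modern Approach*, CUP 2009, §1.3. [AroraBarak2009]
-/

namespace Literature.Computability.Cryptography

namespace LWE

namespace MP12

namespace Prog

open _root_.Computability Polynomial Literature.Computability.Complexity Literature.Computability.Complexity.CodeFP
  BLPRS2013

/-! ### List-level samples and their code -/

/-- A sample by representatives: the `a`-values and the `b`-value. [folklore] -/
abbrev LItem : Type := List ℕ × ℕ

/-- A sample tuple by representatives, with its header: `(d, (Q, samples))`. [folklore] -/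
abbrev LData : Type := ℕ × (ℕ × List LItem)

/-- Code of a list-level sample: `⟨⟨1ᵈ, ⟪bin aᵢ⟫⟩, bin b⟩`. [cite: RegevLWE2009, §2 (input format)] -/
def itemE : LItem → List Bool := pairE (listE natE) natE

/-- Code of list-level data: `⟨bin d, ⟨bin Q, ⟨1ᵐ, ⟪items⟫⟩⟩⟩`. [cite: RegevLWE2009, §2 (input format)] -/
def ldataE : LData → List Bool := pairE natE (pairE natE (listE itemE))

/-- The list form of a typed sample. [folklore] -/
def toItem {d Q : ℕ} (x : (Fin d → ZMod Q) × ZMod Q) : LItem := (List.ofFn fun i => (x.1 i).val, x.2.val)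

/-- The list form of a typed sample tuple. [folklore] -/
def toLData {m d Q : ℕ} (S : Fin m → (Fin d → ZMod Q) × ZMod Q) : LData := (d, (Q, List.ofFn fun j => toItem (S j)))

/-- The item code is the tree's sample code. [folklore] -/
theorem itemE_toItem {d Q : ℕ} (x : (Fin d → ZMod Q) × ZMod Q) : itemE (toItem x) = lweSampleCode x := by
  rw [itemE, toItem, pairE_apply, lweSampleCode]
  simp only [listE, List.length_ofFn, unE_eq_ones, rawE, List.map_ofFn]
  rfl

/-- **The code of the list form is `encodeLWESamples`.** [cite: RegevLWE2009, §2 (input format)] -/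
theorem ldataE_toLData {m d Q : ℕ} (S : Fin m → (Fin d → ZMod Q) × ZMod Q) : ldataE (toLData S) = encodeLWESamples S := by
  rw [encodeLWESamples_eq, ldataE, toLData, pairE_apply, pairE_apply]
  simp only [listE, List.length_ofFn, unE_eq_ones, rawE, List.map_ofFn]
  congr 3
  rw [lweBlockCode]
  congr 1
  exact congrArg List.ofFn (funext fun p => itemE_toItem (S p))

/-- The uniform bound on the length of the code of `m` samples in dimension `d` mod `Q`. [folklore] -/
def ldataBound (d Q m : ℕ) : ℕ :=
  2 * (natE d).length + 2 + (2 * (natE Q).length + 2 + (2 * m + 2 + m * (2 * (8 * d + 6 + (4 * d + 1) * (natE Q).length) + 2)))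

/-- `|encodeLWESamples S| ≤ ldataBound d Q m`. [folklore] -/
theorem length_encodeLWESamples_le_ldataBound {m d Q : ℕ} [NeZero Q] (S : Fin m → (Fin d → ZMod Q) × ZMod Q) :
    (encodeLWESamples S).length ≤ ldataBound d Q m :=
  length_encodeLWESamples_le S

/-- The length bound on codes. [cite: AroraBarak2009, §1.3] -/
theorem codeFP_ldataBound : CodeFP (pairE natE (pairE natE natE)) natE (fun p => ldataBound p.1 p.2.1 p.2.2) := by
  have hd : CodeFP (pairE natE (pairE natE natE)) natE (fun p => p.1) := fst _ _
  have hQ : CodeFP (pairE natE (pairE natE natE)) natE (fun p => p.2.1) := (snd _ _).fst'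
  have hm : CodeFP (pairE natE (pairE natE natE)) natE (fun p => p.2.2) := (snd _ _).snd'
  have hld : CodeFP (pairE natE (pairE natE natE)) natE (fun p => (natE p.1).length) := (strNatLength.comp strOfNat).comp hd
  have hlQ : CodeFP (pairE natE (pairE natE natE)) natE (fun p => (natE p.2.1).length) := (strNatLength.comp strOfNat).comp hQ
  have c2 : CodeFP (pairE natE (pairE natE natE)) natE (fun _ => 2) := const _ 2
  have hsb : CodeFP (pairE natE (pairE natE natE)) natE (fun p => 8 * p.1 + 6 + (4 * p.1 + 1) * (natE p.2.1).length) :=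
    natAdd.comp ((natAdd.comp ((natMul.comp ((const _ 8).pair hd)).pair (const _ 6))).pair
      (natMul.comp ((natAdd.comp ((natMul.comp ((const _ 4).pair hd)).pair (const _ 1))).pair hlQ)))
  exact (natAdd.comp ((natAdd.comp ((natMul.comp (c2.pair hld)).pair c2)).pair
    (natAdd.comp ((natAdd.comp ((natMul.comp (c2.pair hlQ)).pair c2)).pair
      (natAdd.comp ((natAdd.comp ((natMul.comp (c2.pair hm)).pair c2)).pair
        (natMul.comp (hm.pair (natAdd.comp ((natMul.comp (c2.pair hsb)).pair c2)))))))))).congr fun p => rfl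

/-! ### The schedule as numbers computed from `1ⁿ` -/

section Prm

variable (c : ℕ) (m₂ : ℕ → ℕ) (coinsD : Polynomial ℕ)

/-- **The parameter tuple of the machine at security parameter `n`**:
`(d, e, Q, m, K, invGap, T, N, N', m', ℓ)` — dimension, exponent and modulus `Q = 2ᵉ`, the
distinguisher's sample count, the aggregation `K = (⌊log₂ n⌋+1)⁴`, the inverse test accuracy, the
trials, the oracle calls per estimate, the measurements per level, the top samples, and the coins per
call. [cite: MicciancioPeikert2012, Thm. 3.1 proof (pp. 15–16)] -/
def prmOf (n : ℕ) : ℕ × ℕ × ℕ × ℕ × ℕ × ℕ × ℕ × ℕ × ℕ × ℕ × ℕ :=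
  (dim n, lev n, 2 ^ lev n, m₂ n, logSucc n ^ 4, invGap c n, trials c n, reps c n, meas c n, extra n,
    coinsD.eval (2 * n + 2 + ldataBound (dim n) (2 ^ lev n) (m₂ n)))

/-- The aggregation component is `aggK n`. [folklore] -/
theorem prmOf_aggK (n : ℕ) : (prmOf c m₂ coinsD n).2.2.2.2.1 = aggK n := by
  simp only [prmOf, aggK, logK, logSucc_eq]

variable {m₂}

/-- **The parameter tuple is computed from `1ⁿ` in polynomial time.** [cite: AroraBarak2009, §1.3] -/
theorem codeFP_prmOf (hm₂ : CodeFP unE natE m₂) : CodeFP unE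
    (pairE natE (pairE natE (pairE natE (pairE natE (pairE natE (pairE natE (pairE natE (pairE natE (pairE natE (pairE natE natE))))))))))
    (prmOf c m₂ coinsD) := by
  have hn : CodeFP unE natE (fun n => n) := natOfUn
  have hd : CodeFP unE natE dim := natSqrt.comp hn
  have he : CodeFP unE natE lev := (natAdd.comp ((natDiv.comp (hd.pair (const _ 2))).pair (const _ 2))).congr fun n => rfl
  -- `e ≤ n + 2`, so the unary exponent capped at `n + 2` is `e`
  have heu : CodeFP unE unE lev := (unOfNatMin.comp ((unAdd.comp ((CodeFP.id unE).pair (const _ 2))).pair he)).congr fun n => by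
    have := lev_le n
    simp only [id_eq]
    exact Nat.min_eq_left this
  have hQ : CodeFP unE natE (fun n => 2 ^ lev n) := natPow.comp ((const _ 2).pair heu)
  have hK : CodeFP unE natE (fun n => logSucc n ^ 4) := (natPow.comp ((codeFP_logSucc.comp hn).pair (const _ 4))).congr fun n => rfl
  have hnc : CodeFP unE natE (fun n => n ^ c) := (natPow.comp (hn.pair (const _ c))).congr fun n => rfl
  have hG : CodeFP unE natE (invGap c) := (natMul.comp ((natMul.comp ((const _ 8).pair he)).pair hnc)).congr fun n => rfl
  have hX : CodeFP unE natE slack := (natMul.comp ((natMul.comp ((const _ 24).pair hd)).pair he)).congr fun n => rfl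
  have hT : CodeFP unE natE (trials c) := (natMul.comp ((natMul.comp ((const _ 2).pair hX)).pair hG)).congr fun n => rfl
  have hN : CodeFP unE natE (reps c) :=
    (natMul.comp ((natMul.comp ((natMul.comp ((const _ 8).pair hT)).pair hX)).pair (natMul.comp (hG.pair hG)))).congr fun n => by
      simp only [reps]; ring
  have hN' : CodeFP unE natE (meas c) :=
    (natMul.comp ((natMul.comp ((const _ 768).pair (natPow.comp ((natAdd.comp (he.pair (const _ 1))).pair (const _ 3))))).pair
      (natPow.comp (hn.pair (const _ (2 * c)))))).congr fun n => rfl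
  have hm' : CodeFP unE natE extra := (natAdd.comp (hd.pair (const _ 4))).congr fun n => rfl
  have hℓ : CodeFP unE natE (fun n => coinsD.eval (2 * n + 2 + ldataBound (dim n) (2 ^ lev n) (m₂ n))) :=
    (codeFP_polyEval coinsD).comp (natAdd.comp ((natAdd.comp ((natMul.comp ((const _ 2).pair hn)).pair (const _ 2))).pair
      (codeFP_ldataBound.comp (hd.pair (hQ.pair hm₂)))))
  exact (hd.pair (he.pair (hQ.pair (hm₂.pair (hK.pair (hG.pair (hT.pair (hN.pair (hN'.pair (hm'.pair hℓ)))))))))).congr fun n => rfl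

end Prm

end Prog

end MP12

end LWE

end Literature.Computability.Cryptography
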